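import Literature.MathematicalPhysics.QuantumFieldTheory.Balaban1983to89.T4EMLFibreAC

/-!
# Route `UnitScaleTilt` — crux K1bR-pr `FluctuationComparisonRegPr` (stmt-QuantumFields-19201), «Lemma B» line, step S-B2b:
# THE ANALYTIC DATUM OF THE EXP-MEAN-LOG FIBRE MAP — the cone extension of `u ↦ exp(Σ_k c_k • qlog(a_k (p u q)^*))·(p u q)` is
# jointly `C¹` in the environment `(a, p, q)` and the variable, with INVERTIBLE `ℍ`-part of its derivative at unit points
# (support file `--supports stmt-QuantumFields-19201`; quaternion calculus only)

Fleet lead `ym-ust-19201-p1` (gen 0).  Input of the parametric inverse function theorem `SU2ParametricSubmersion.su2_fibrewise_of_hasStrictFDerivAt'`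
for the one-variable law of Bałaban's (0.4) averaging with the printed `exp[mean log]` on `SU(2)`: in the private bond variable `g` and the
quaternion model (`T4EMLFibreAC`: `kf a c v = exp(Σ_k c_k • qlog(a_k v̄))·v`), with the frozen holonomies `a_k`, `pre = p`, `post = q` as
ENVIRONMENT `e = (a, p, q) ∈ Env := (ι → ℍ) × ℍ × ℍ`, the law is `u ↦ kf a c (p u q)` and its cone extension is the explicit map
`Φ (e, x) = ‖x‖ • kf a c (p (‖x‖⁻¹ • x) q)` — written out in every statement (no definition is introduced).

* `norm_kf_eq_one` — unit environment, unit argument, guard `‖a_k v̄ − 1‖ < 1` ⇒ `‖kf a c v‖ = 1` (the exponent is imaginary).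
* `contDiffAt_coneKf` — `Φ` is `C¹` (indeed `C^n`) at every `(e, x)` with `x ≠ 0` and `‖a_k (p x̂ q)^* − 1‖ < 1` (chain rule through
  `contDiffAt_qlog`, the analytic `exp`, `contDiffAt_norm`); `differentiableAt_coneKf` — the fibre maps `Φ(e, ·)` are differentiable there.
* **`exists_strictFDeriv_coneKf`** — at a unit `u₀`, unit `a_k, p, q`, weights `c_k ≥ 0` of total `< 1` and guard `< 1/2`: `Φ` has a strict
  derivative `L` at `(e, u₀)` and its `ℍ`-part `L ∘ inr` is an isomorphism (`T4EMLFibreAC.kD_tangent_injective` transported along the isometry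
  `v ↦ p v q`, `T4HaarSU2LocalDiffeo.exists_equiv_hasStrictFDerivAt_coneExt`, uniqueness of the derivative).
Every declaration is [folklore] calculus; nothing of Bałaban's is asserted.
-/

noncomputable section

open NormedSpace Set Metric Function Filter
open scoped RealInnerProductSpace Topology Quaternion

namespace Summit.QuantumFields.YangMills.Theorems.EMLFibreSubmersion

open Literature.MathematicalPhysics.QuantumFieldTheory.Balaban1983to89.T4QuatExpLog (qlog contDiffAt_qlog qlog_re_of_norm_eq_one
  norm_exp_of_re_eq_zero)
open Literature.MathematicalPhysics.QuantumFieldTheory.Balaban1983to89.T4EMLFibreAC (kf Yf kD mulStarCLM mulStarCLM_apply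
  hasStrictFDerivAt_kf kD_tangent_injective)
open Literature.MathematicalPhysics.QuantumFieldTheory.Balaban1983to89.T4HaarSU2LocalDiffeo (exists_equiv_hasStrictFDerivAt_coneExt)

variable {ι : Type*} [Fintype ι]

/-- The exponent of the fibre map is IMAGINARY at a unit argument with unit `a_k` inside the guard. [folklore] -/
theorem Yf_re_eq_zero {a : ι → ℍ} (c : ι → ℝ) {v : ℍ} (ha : ∀ k, ‖a k‖ = 1) (hv : ‖v‖ = 1) (hg : ∀ k, ‖a k * star v - 1‖ < 1) :
    (Yf a c v).re = 0 := by
  unfold Yf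
  refine Finset.sum_induction _ (fun q : ℍ => q.re = 0) (fun x y hx hy => by rw [Quaternion.re_add, hx, hy, add_zero]) rfl
    fun k _ => ?_
  have h1 : ‖a k * star v‖ = 1 := by rw [norm_mul, norm_star, ha k, hv, mul_one]
  rw [Quaternion.re_smul, qlog_re_of_norm_eq_one h1 (hg k), smul_zero]

/-- **THE FIBRE MAP TAKES UNIT VALUES** at unit arguments (unit `a_k`, guard `< 1`). [folklore] -/
theorem norm_kf_eq_one {a : ι → ℍ} (c : ι → ℝ) {v : ℍ} (ha : ∀ k, ‖a k‖ = 1) (hv : ‖v‖ = 1) (hg : ∀ k, ‖a k * star v - 1‖ < 1) :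
    ‖kf a c v‖ = 1 := by
  unfold kf
  rw [norm_mul, norm_exp_of_re_eq_zero (Yf_re_eq_zero c ha hv hg), hv, mul_one]

/-- The two-sided translation `v ↦ p v q` by unit quaternions preserves norms. [folklore] -/
theorem norm_mul_mul_of_unit {p q : ℍ} (hp : ‖p‖ = 1) (hq : ‖q‖ = 1) (v : ℍ) : ‖p * v * q‖ = ‖v‖ := by
  rw [norm_mul, norm_mul, hp, hq, one_mul, mul_one]

/-- The two-sided translation by unit quaternions preserves inner products (polarisation). [folklore] -/
theorem inner_mul_mul_of_unit {p q : ℍ} (hp : ‖p‖ = 1) (hq : ‖q‖ = 1) (u v : ℍ) : ⟪p * u * q, p * v * q⟫ = ⟪u, v⟫ := by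
  rw [real_inner_eq_norm_mul_self_add_norm_mul_self_sub_norm_sub_mul_self_div_two,
    real_inner_eq_norm_mul_self_add_norm_mul_self_sub_norm_sub_mul_self_div_two,
    show p * u * q - p * v * q = p * (u - v) * q by rw [mul_sub, sub_mul],
    norm_mul_mul_of_unit hp hq, norm_mul_mul_of_unit hp hq, norm_mul_mul_of_unit hp hq]

/-- **JOINT SMOOTHNESS OF THE CONE EXTENSION** `Φ (e, x) = ‖x‖ • kf a c (p (‖x‖⁻¹ • x) q)`, `e = (a, p, q)`, at every `(e, x)` with
`x ≠ 0` and guard `‖a_k (p x̂ q)^* − 1‖ < 1`. [folklore] -/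
theorem contDiffAt_coneKf (c : ι → ℝ) {n : WithTop ℕ∞} {e : (ι → ℍ) × ℍ × ℍ} {x : ℍ} (hx : x ≠ 0)
    (hg : ∀ k, ‖e.1 k * star (e.2.1 * (‖x‖⁻¹ • x) * e.2.2) - 1‖ < 1) :
    ContDiffAt ℝ n (fun z : ((ι → ℍ) × ℍ × ℍ) × ℍ => ‖z.2‖ • kf z.1.1 c (z.1.2.1 * (‖z.2‖⁻¹ • z.2) * z.1.2.2)) (e, x) := by
  -- the building blocks
  have h1 : ContDiffAt ℝ n (fun z : ((ι → ℍ) × ℍ × ℍ) × ℍ => ‖z.2‖) (e, x) :=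
    (contDiffAt_norm ℝ hx).comp (e, x) contDiffAt_snd
  have h2 : ContDiffAt ℝ n (fun z : ((ι → ℍ) × ℍ × ℍ) × ℍ => ‖z.2‖⁻¹ • z.2) (e, x) :=
    (h1.inv (norm_ne_zero_iff.mpr hx)).smul contDiffAt_snd
  have h3 : ContDiffAt ℝ n (fun z : ((ι → ℍ) × ℍ × ℍ) × ℍ => z.1.2.1 * (‖z.2‖⁻¹ • z.2) * z.1.2.2) (e, x) :=
    ((contDiffAt_fst.comp (e, x) (contDiffAt_snd.comp (e, x) contDiffAt_fst)).mul h2).mul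
      (contDiffAt_snd.comp (e, x) (contDiffAt_snd.comp (e, x) contDiffAt_fst))
  have h4 : ∀ k, ContDiffAt ℝ n (fun z : ((ι → ℍ) × ℍ × ℍ) × ℍ => z.1.1 k * star (z.1.2.1 * (‖z.2‖⁻¹ • z.2) * z.1.2.2)) (e, x) := by
    intro k
    have hk : ContDiffAt ℝ n (fun z : ((ι → ℍ) × ℍ × ℍ) × ℍ => z.1.1 k) (e, x) :=
      ((ContinuousLinearMap.proj k : (ι → ℍ) →L[ℝ] ℍ).contDiff.contDiffAt).comp (e, x)
        (contDiffAt_fst.comp (e, x) contDiffAt_fst)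
    have hstar : ContDiffAt ℝ n (fun z : ((ι → ℍ) × ℍ × ℍ) × ℍ => star (z.1.2.1 * (‖z.2‖⁻¹ • z.2) * z.1.2.2)) (e, x) := by
      have := ((mulStarCLM (1 : ℍ)).contDiff.contDiffAt).comp (e, x) h3
      simpa only [Function.comp_def, mulStarCLM_apply, one_mul] using this
    exact hk.mul hstar
  have h5 : ContDiffAt ℝ n (fun z : ((ι → ℍ) × ℍ × ℍ) × ℍ =>
      ∑ k, c k • qlog (z.1.1 k * star (z.1.2.1 * (‖z.2‖⁻¹ • z.2) * z.1.2.2))) (e, x) := by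
    refine ContDiffAt.sum fun k _ => ?_
    exact ((contDiffAt_qlog (hg k)).comp (e, x) (h4 k)).const_smul (c k)
  have h6 : ContDiffAt ℝ n (fun z : ((ι → ℍ) × ℍ × ℍ) × ℍ =>
      exp (∑ k, c k • qlog (z.1.1 k * star (z.1.2.1 * (‖z.2‖⁻¹ • z.2) * z.1.2.2)))) (e, x) :=
    ((NormedSpace.exp_analytic (𝕂 := ℝ) _).contDiffAt).comp (e, x) h5
  have h7 : ContDiffAt ℝ n (fun z : ((ι → ℍ) × ℍ × ℍ) × ℍ => ‖z.2‖ •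
      (exp (∑ k, c k • qlog (z.1.1 k * star (z.1.2.1 * (‖z.2‖⁻¹ • z.2) * z.1.2.2))) *
        (z.1.2.1 * (‖z.2‖⁻¹ • z.2) * z.1.2.2))) (e, x) := h1.fun_smul (h6.mul h3)
  exact h7

/-- The fibre maps `Φ(e, ·)` are differentiable at every `x ≠ 0` inside the guard. [folklore] -/
theorem differentiableAt_coneKf (c : ι → ℝ) (e : (ι → ℍ) × ℍ × ℍ) {x : ℍ} (hx : x ≠ 0)
    (hg : ∀ k, ‖e.1 k * star (e.2.1 * (‖x‖⁻¹ • x) * e.2.2) - 1‖ < 1) :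
    DifferentiableAt ℝ (fun y : ℍ => ‖y‖ • kf e.1 c (e.2.1 * (‖y‖⁻¹ • y) * e.2.2)) x := by
  have h := (contDiffAt_coneKf c (n := 1) hx hg).differentiableAt one_ne_zero
  exact h.comp x ((differentiableAt_const e).prodMk differentiableAt_id)

/-- **THE ANALYTIC DATUM.**  At a unit `u₀`, with unit `a_k`, `p`, `q`, weights `c_k ≥ 0` of total `< 1` and guard
`‖a_k (p u₀ q)^* − 1‖ < 1/2`, the cone extension `Φ` has a STRICT derivative `L` at `((a, p, q), u₀)` whose `ℍ`-part `L ∘ inr` is an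
isomorphism `D`. [folklore] -/
theorem exists_strictFDeriv_coneKf {c : ι → ℝ} (hc : ∀ k, 0 ≤ c k) (hs : ∑ k, c k < 1)
    {a : ι → ℍ} (ha : ∀ k, ‖a k‖ = 1) {p q u₀ : ℍ} (hp : ‖p‖ = 1) (hq : ‖q‖ = 1) (hu₀ : ‖u₀‖ = 1)
    (hg : ∀ k, ‖a k * star (p * u₀ * q) - 1‖ < 1 / 2) :
    ∃ (L : ((ι → ℍ) × ℍ × ℍ) × ℍ →L[ℝ] ℍ) (D : ℍ ≃L[ℝ] ℍ),
      HasStrictFDerivAt (fun z : ((ι → ℍ) × ℍ × ℍ) × ℍ => ‖z.2‖ • kf z.1.1 c (z.1.2.1 * (‖z.2‖⁻¹ • z.2) * z.1.2.2)) L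
        ((a, p, q), u₀) ∧
      (D : ℍ →L[ℝ] ℍ) = L.comp (ContinuousLinearMap.inr ℝ ((ι → ℍ) × ℍ × ℍ) ℍ) := by
  have hu₀0 : u₀ ≠ 0 := fun h => by rw [h, norm_zero] at hu₀; exact zero_ne_one hu₀
  have hunit : ‖u₀‖⁻¹ • u₀ = u₀ := by rw [hu₀, inv_one, one_smul]
  have hg1 : ∀ k, ‖a k * star (p * (‖u₀‖⁻¹ • u₀) * q) - 1‖ < 1 := fun k => by
    rw [hunit]; exact (hg k).trans (by norm_num)
  -- joint strict derivative
  have hΦ := (contDiffAt_coneKf c (n := 1) (e := (a, p, q)) hu₀0 hg1).hasStrictFDerivAt one_ne_zero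
  set L := fderiv ℝ (fun z : ((ι → ℍ) × ℍ × ℍ) × ℍ => ‖z.2‖ • kf z.1.1 c (z.1.2.1 * (‖z.2‖⁻¹ • z.2) * z.1.2.2)) ((a, p, q), u₀)
    with hL
  -- the fibre map at the base environment and its derivative
  set M : ℍ →L[ℝ] ℍ := ContinuousLinearMap.mulLeftRight ℝ ℍ p q with hM
  have hMapply : ∀ v, M v = p * v * q := fun v => ContinuousLinearMap.mulLeftRight_apply ℝ ℍ p q v
  have hpu : ‖p * u₀ * q‖ = 1 := by rw [norm_mul_mul_of_unit hp hq, hu₀]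
  have hk : HasStrictFDerivAt (fun u : ℍ => kf a c (p * u * q)) ((kD a c (p * u₀ * q)).comp M) (‖u₀‖⁻¹ • u₀) := by
    rw [hunit]
    have h1 := hasStrictFDerivAt_kf c (u := p * u₀ * q) (a := a) fun k => (hg k).trans (by norm_num)
    have h2 : HasStrictFDerivAt (fun u : ℍ => p * u * q) M u₀ := by
      have := M.hasStrictFDerivAt (x := u₀)
      refine this.congr_of_eventuallyEq (Filter.Eventually.of_forall fun v => (hMapply v))
    exact h1.comp u₀ h2
  -- unit values near `u₀`
  have hcont : ContinuousAt (fun y : ℍ => fun k => ‖a k * star (p * (‖y‖⁻¹ • y) * q) - 1‖) u₀ := by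
    refine continuousAt_pi.mpr fun k => ?_
    have hy : ContinuousAt (fun y : ℍ => ‖y‖⁻¹ • y) u₀ :=
      ((continuous_norm.continuousAt).inv₀ (norm_ne_zero_iff.mpr hu₀0)).smul continuousAt_id
    exact (((continuousAt_const.mul hy).mul continuousAt_const).star.const_mul _ |>.sub continuousAt_const).norm
  have hev : ∀ᶠ y in 𝓝 u₀, y ≠ 0 ∧ ∀ k, ‖a k * star (p * (‖y‖⁻¹ • y) * q) - 1‖ < 1 := by
    refine (eventually_ne_nhds hu₀0).and ?_
    have hopen : IsOpen {f : ι → ℝ | ∀ k, f k < 1} := by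
      rw [show {f : ι → ℝ | ∀ k, f k < 1} = ⋂ k, {f | f k < 1} by ext; simp]
      exact isOpen_iInter_of_finite fun k => isOpen_lt (continuous_apply k) continuous_const
    exact hcont.preimage_mem_nhds (hopen.mem_nhds fun k => hg1 k)
  have heq : ∀ᶠ y in 𝓝 u₀, ‖(fun y : ℍ => ‖y‖ • kf a c (p * (‖y‖⁻¹ • y) * q)) y‖ = ‖y‖ := by
    filter_upwards [hev] with y hy
    have hy1 : ‖‖y‖⁻¹ • y‖ = 1 := by
      rw [norm_smul, norm_inv, norm_norm, inv_mul_cancel₀ (norm_ne_zero_iff.mpr hy.1)]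
    show ‖‖y‖ • kf a c (p * (‖y‖⁻¹ • y) * q)‖ = ‖y‖
    rw [norm_smul, norm_norm, norm_kf_eq_one c ha (by rw [norm_mul_mul_of_unit hp hq, hy1]) hy.2, mul_one]
  -- tangent injectivity transported along the isometry `M`
  have hinj : ∀ v, ⟪u₀, v⟫ = 0 → ((kD a c (p * u₀ * q)).comp M) v = 0 → v = 0 := by
    intro v hv h0
    rw [ContinuousLinearMap.comp_apply] at h0
    have horth : ⟪p * u₀ * q, M v⟫ = 0 := by rw [hMapply, inner_mul_mul_of_unit hp hq, hv]
    have hMv := kD_tangent_injective hpu ha hc hs hg (M v) horth h0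
    rw [hMapply] at hMv
    have hp0 : p ≠ 0 := fun h => by rw [h, norm_zero] at hp; exact zero_ne_one hp
    have hq0 : q ≠ 0 := fun h => by rw [h, norm_zero] at hq; exact zero_ne_one hq
    rcases mul_eq_zero.mp hMv with h | h
    · rcases mul_eq_zero.mp h with h' | h'
      · exact absurd h' hp0
      · exact h'
    · exact absurd h hq0
  -- the cone extension at the base environment has an invertible strict derivative
  obtain ⟨D, hD⟩ := exists_equiv_hasStrictFDerivAt_coneExt (F := fun y : ℍ => ‖y‖ • kf a c (p * (‖y‖⁻¹ • y) * q))
    hu₀0 hk Filter.EventuallyEq.rfl heq hinj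
  refine ⟨L, D, hΦ, ?_⟩
  -- uniqueness of the derivative along the fibre `{(a, p, q)} × ℍ`
  have h1 : HasFDerivAt (fun y : ℍ => ‖y‖ • kf a c (p * (‖y‖⁻¹ • y) * q))
      (L.comp (ContinuousLinearMap.inr ℝ ((ι → ℍ) × ℍ × ℍ) ℍ)) u₀ :=
    hΦ.hasFDerivAt.comp u₀ (hasFDerivAt_prodMk_right ((a, p, q) : (ι → ℍ) × ℍ × ℍ) u₀)
  exact hD.hasFDerivAt.unique h1

end Summit.QuantumFields.YangMills.Theorems.EMLFibreSubmersion

end
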